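import Literature.Analysis.FluidPDE.QuasiSelfSimilarMoveSP07
import HarnessLib

/-!
# Straight move, phase 7: re-description certificates towards phase 8

Topic `Literature/Analysis/FluidPDE`. Emitted data / kernel certificates of the explicit straight generating
move (`S`) in the typed-chain model, under the contract of `PlanarGeneratorAssembly.lean`
(`acm_compatible_blocks_of_slots`). Generated by the author's emitter from the exact rational design;
no named facts, every theorem is decided in the kernel or assembled from decided chunks. [folklore]

## References

* G. Alberti, G. Crippa, A. L. Mazzucato, *Exponential self-similar mixing by incompressible
  flows*, J. Amer. Math. Soc. 32 (2019), 445–490, §8 (arXiv:1605.02090).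
-/

noncomputable section

namespace Literature.Analysis.FluidPDE.QuasiSelfSimilar.MoveS

open PlanarKinematics QuasiSelfSimilar

/-- Cover certificate of the end keyframe of phase 7 by the start keyframe of phase 8. [folklore] -/
def rc07 : List (Fin 2 × List (ℕ × EquivCert)) := [(0, [(0, .same)]), (0, [(1, .same)]), (0, [(1, .same)]), (0, [(1, .same)]), (0, [(2, .same)]), (1, [(3, .same)]), (1, [(4, .same)]), (1, [(5, .same)]), (0, [(6, .same)]), (0, [(7, .same)]), (0, [(8, .same)]), (0, [(9, .same)]), (0, [(10, .same)]), (1, [(11, .same)]), (1, [(12, .same)]), (1, [(13, .same)]), (0, [(14, .same)]), (0, [(15, .same)]), (0, [(16, .same)]), (0, [(17, .same)]), (0, [(18, .same)]), (1, [(19, .same)]), (1, [(20, .same)]), (1, [(21, .same)]), (0, [(22, .same)]), (0, [(23, .same)]), (0, [(24, .same)]), (0, [(25, .same)]), (0, [(26, .same)]), (1, [(27, .same)]), (1, [(28, .same)]), (1, [(29, .same)]), (0, [(30, .same)]), (0, [(31, .same)]), (0, [(32, .same)]), (0, [(33, .same)]), (0, [(34, .same)]), (1, [(35, .same)]), (1,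 [(36, .same)]), (1, [(37, .same)]), (0, [(38, .same)]), (0, [(39, .same)]), (0, [(40, .same)]), (0, [(41, .same)]), (0, [(42, .same)]), (1, [(43, .same)]), (1, [(44, .same)]), (1, [(45, .same)]), (0, [(46, .same)]), (0, [(47, .same)]), (0, [(47, .same)]), (0, [(47, .same)]), (0, [(48, .same)])]

/-- Cover certificate of the start keyframe of phase 8 by the end keyframe of phase 7. [folklore] -/
def rc07' : List (Fin 2 × List (ℕ × EquivCert)) := [(0, [(0, .same)]), (0, [(1, .same), (2, .same), (3, .same)]), (0, [(4, .same)]), (1, [(5, .same)]), (1, [(6, .same)]), (1, [(7, .same)]), (0, [(8, .same)]), (0, [(9, .same)]), (0, [(10, .same)]), (0, [(11, .same)]), (0, [(12, .same)]), (1, [(13, .same)]), (1, [(14, .same)]), (1, [(15, .same)]), (0, [(16, .same)]), (0, [(17, .same)]), (0, [(18, .same)]), (0, [(19, .same)]), (0, [(20, .same)]), (1, [(21, .same)]), (1, [(22, .same)]), (1, [(23, .same)]), (0, [(24, .same)]), (0, [(25, .same)]), (0, [(26, .same)]), (0, [(27, .same)]), (0, [(28, .same)]), (1, [(29, .same)]),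 (1, [(30, .same)]), (1, [(31, .same)]), (0, [(32, .same)]), (0, [(33, .same)]), (0, [(34, .same)]), (0, [(35, .same)]), (0, [(36, .same)]), (1, [(37, .same)]), (1, [(38, .same)]), (1, [(39, .same)]), (0, [(40, .same)]), (0, [(41, .same)]), (0, [(42, .same)]), (0, [(43, .same)]), (0, [(44, .same)]), (1, [(45, .same)]), (1, [(46, .same)]), (1, [(47, .same)]), (0, [(48, .same)]), (0, [(49, .same), (50, .same), (51, .same)]), (0, [(52, .same)])]

end Literature.Analysis.FluidPDE.QuasiSelfSimilar.MoveS

end
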